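import Summits.QuantumFields.QCD.Theses.OverlapPositivityTransfer

/-!
# Birth skeleton — piece B `OverlapLimitPositivity` of the decomposition of `OverlapContinuumLimit`

Line: ASYMPTOTIC REFLECTION POSITIVITY + CLOSURE.  Exact lattice reflection positivity FAILS for the
admissibility-cut gauge weight (Creutz 2004, hep-lat/0409017: the cut is incompatible with a positive transfer
matrix) and is open for interacting overlap quarks (Kikukawa–Usui 2010, free case only); what E2 of the LIMIT
needs is only `stub_asymptoticRP` (hard): along an asymptotically scaling overlap scheme with convergent
renormalised Schwinger functions, the OS quadratic form on finite complex combinations of positive-time REAL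
tensors is asymptotically non-negative (`liminf ≥ 0`, imaginary part `→ 0`).  `stub_rpClosure` (soft: density of
such combinations among time-ordered test functions, continuity of `S`, `S.IsNormalized` for the arity-0 terms):
asymptotic positivity of the lattice forms gives `S.IsReflectionPositive`.  `OverlapLimitPositivity_of` composes.
-/

namespace Summit.QuantumFields.QCD.Cruxes.OverlapLimitPositivity.Birth

open scoped BigOperators Topology ComplexConjugate
open Filter
open Literature.MathematicalPhysics.QuantumFieldTheory Literature.MathematicalPhysics.QuantumLattice
  Literature.MathematicalPhysics.AQFT
open Summit.QuantumFields.QCD.Theses.OverlapPositivityTransfer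

/-- ASYMPTOTIC RP (hard): the OS forms of admissible-overlap lattice QCD are asymptotically non-negative. -/
theorem stub_asymptoticRP : ∀ Nf : ℕ, Nf = 2 ∨ Nf = 3 → ∀ sch : QCDScheme Nf, sch.HasAsymptoticScaling → (∀ fl : Fin Nf, ∀ᶠ k in Filter.atTop, 0 < sch.mq fl k ∧ sch.mq fl k < 2) → (∃ Δ : ℝ, 0 < Δ ∧ sch.OverlapHasLatticeMassGap Δ) → (∀ n : ℕ, n ≠ 0 → ∀ (σ : Fin n → QCDField Nf) (f : Fin n → SchwartzMap (EuclideanSpace ℝ (Fin 4)) ℝ) (F : SchwartzMap (Fin n → EuclideanSpace ℝ (Fin 4)) ℂ), IsTensorOf F (fun i => ofRealTest (f i)) → IsOffDiagonal F → ∃ c : ℂ, Filter.Tendsto (fun k : ℕ => overlapLatticeSchwinger sch k n σ f) Filter.atTop (nhds c)) → (∀ (N : ℕ) (deg : Fin N → ℕ) (lab : (j : Fin N) → Fin (deg j) → QCDField Nf) (f : (j : Fin N) → Fin (deg j) → SchwartzMap (EuclideanSpace ℝ (Fin 4)) ℝ) (c : Fin N → ℂ), (∀ j i, tsupport ((f j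 i : SchwartzMap (EuclideanSpace ℝ (Fin 4)) ℝ) : EuclideanSpace ℝ (Fin 4) → ℝ) ⊆ {x | 0 < x 0}) → ∀ ε > (0 : ℝ), ∀ᶠ k in Filter.atTop, -ε ≤ (∑ i, ∑ j, starRingEnd ℂ (c i) * c j * overlapLatticeSchwinger sch k (deg i + deg j) (Fin.append (lab i ∘ Fin.rev) (lab j)) (Fin.append (fun l => thetaTest 4 (f i (Fin.rev l))) (f j))).re ∧ |(∑ i, ∑ j, starRingEnd ℂ (c i) * c j * overlapLatticeSchwinger sch k (deg i + deg j) (Fin.append (lab i ∘ Fin.rev) (lab j)) (Fin.append (fun l => thetaTest 4 (f i (Fin.rev l))) (f j))).im| ≤ ε) := by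
  sorry

/-- CLOSURE (soft): asymptotic positivity on real positive-time tensors gives E2 of the limit. -/
theorem stub_rpClosure : ∀ (Nf : ℕ) (sch : QCDScheme Nf) (S : LabelledSchwingerFamily (QCDField Nf) (EuclideanSpace ℝ (Fin 4))), S.IsNormalized → (∀ n : ℕ, n ≠ 0 → ∀ (σ : Fin n → QCDField Nf) (f : Fin n → SchwartzMap (EuclideanSpace ℝ (Fin 4)) ℝ) (F : SchwartzMap (Fin n → EuclideanSpace ℝ (Fin 4)) ℂ), IsTensorOf F (fun i => ofRealTest (f i)) → IsOffDiagonal F → Filter.Tendsto (fun k : ℕ => overlapLatticeSchwinger sch k n σ f) Filter.atTop (nhds (S n σ F))) → (∀ (N : ℕ) (deg : Fin N → ℕ) (lab : (j : Fin N) → Fin (deg j) → QCDField Nf) (f : (j : Fin N) → Fin (deg j) → SchwartzMap (EuclideanSpace ℝ (Fin 4)) ℝ) (c : Fin N → ℂ), (∀ j i, tsupport ((f j i : SchwartzMap (EuclideanSpace ℝ (Fin 4)) ℝ) : EuclideanSpace ℝ (Fin 4) → ℝ) ⊆ {x | 0 < x 0}) → ∀ ε > (0 : ℝ), ∀ᶠ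 k in Filter.atTop, -ε ≤ (∑ i, ∑ j, starRingEnd ℂ (c i) * c j * overlapLatticeSchwinger sch k (deg i + deg j) (Fin.append (lab i ∘ Fin.rev) (lab j)) (Fin.append (fun l => thetaTest 4 (f i (Fin.rev l))) (f j))).re ∧ |(∑ i, ∑ j, starRingEnd ℂ (c i) * c j * overlapLatticeSchwinger sch k (deg i + deg j) (Fin.append (lab i ∘ Fin.rev) (lab j)) (Fin.append (fun l => thetaTest 4 (f i (Fin.rev l))) (f j))).im| ≤ ε) → S.IsReflectionPositive := by
  sorry

/-- Composition (pure logic): asymptotic lattice positivity + closure give piece B. -/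
theorem OverlapLimitPositivity_of :
    Summit.QuantumFields.QCD.Theses.OverlapPositivityTransfer.OverlapLimitPositivity := by
  intro Nf hNf sch S hAF hwin hgap hnorm hconv
  have hc : (∀ n : ℕ, n ≠ 0 → ∀ (σ : Fin n → QCDField Nf) (f : Fin n → SchwartzMap (EuclideanSpace ℝ (Fin 4)) ℝ) (F : SchwartzMap (Fin n → EuclideanSpace ℝ (Fin 4)) ℂ), IsTensorOf F (fun i => ofRealTest (f i)) → IsOffDiagonal F → ∃ c : ℂ, Filter.Tendsto (fun k : ℕ => overlapLatticeSchwinger sch k n σ f) Filter.atTop (nhds c)) :=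
    fun n hn σ f F hF hoff => ⟨S n σ F, hconv n hn σ f F hF hoff⟩
  exact stub_rpClosure Nf sch S hnorm hconv (stub_asymptoticRP Nf hNf sch hAF hwin hgap hc)

end Summit.QuantumFields.QCD.Cruxes.OverlapLimitPositivity.Birth
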